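import Summits.HodgeConjecture.HodgeConjecture.Theorems.F0P3KitOfRecordLawsV8   -- ★ p825117 (p04 (g7)): `laws₈_kitOfRecord_of₄`, `letters_of_kitFamilyOfRecordV8`, `letters_of_specPkgV8` (v6-routing conjunct)
import HarnessLib

/-!
# K9α at v8 WITH THE GUARDED ROUTING ROW — `letters_of_specPkgV8_cot` (ED. 5 of `Cruxes/H413/Lines/F0_U3LettersRung1.lean`, RULING (V54), director s586)

Cell `hodgecm-mathlib`, F0∕P3 «U3-mult», crux H413 (`stmt-HodgeConjecture-24833`); F0P3-p04 (g8).  PROOF lane: one theorem, no `def`, no `sorry`;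
`--supports stmt-HodgeConjecture-24833 --as helper`.

★ `letters_of_specPkgV8 𝔇 h` (p825117) asks, among the fourteen per-frame conjuncts of `h`, for row #15 in its v6 (UNGUARDED) text
`(kitFamilyOfRecord 𝔇 …).Routing` and converts it in-proof by ★ `routing₈_kitOfRecord_of_v6`.  The closer's ED. 5 re-cuts `StubL3` to the GUARDED letter
(«∀ P, IsCot P → ‹CohClassRouting at P›», the T2 pay-down head ★ `F0T2CohClassRoutingCotPaydown.CohClassRoutingCotClosed`, RULING (V54)(3), s586 (i)), which yields
ONLY the guarded v8 row (★ `F0P3RoutingOfCot.routing₈_kitOfRecord_of_cot`, typ-T2a∕p03).  **`letters_of_specPkgV8_cot`** is the same theorem with the NINTH conjunct of `h`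
typed as the guarded v8 law `F0P3InnerFormClassificationV8.ClassificationKit.Routing (kitFamilyOfRecord 𝔇 …)` — exactly what ★ `laws₈_kitOfRecord_of₄`'s `h15` wants, so the
conversion disappears; statement otherwise BYTE-IDENTICAL to ★ `letters_of_specPkgV8`, conclusion unchanged (`StubE1coh`-body ∧ E2′ `hodgeTypeRigid`).  Print exposure of
row #15 thereby drops from «all discrete `P`» to «cotangent `Kc`-trivial `P`» [Rogawski1990 §15.3 ¶1 p. 244; Thm. 13.3.6 (c)], which is what §15.3 asserts.
[cite: Rogawski1990, §14.6 Thm. 14.6.4 pp. 236–244; §15.3 ¶1 p. 244; Prop. 15.2.1 (b)] [cite: BorelWallach2000, VI Thm. 4.11]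
HONEST LABEL: HC_CM is proved only modulo the printed citations until rung 0 closes; this file asserts nothing new (plumbing over ★ K-side V8).
-/


set_option autoImplicit false
set_option linter.dupNamespace false

noncomputable section

open NumberField IsDedekindDomain MeasureTheory
open Literature.NumberTheory.Rogawski1990 Literature.NumberTheory.GaloisRepresentations
open Literature.NumberTheory.Automorphic Literature.NumberTheory.Automorphic.UnitaryGroup
open Literature.NumberTheory.Automorphic.UnitaryGroup.CotangentForms
open Summit.HodgeConjecture.HodgeConjecture.Cruxes.H413.F0P3XiArchPacketOfRecord (JInfNoDegOne DsInfNoDegOne)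
open scoped Matrix ComplexOrder

namespace Summit.HodgeConjecture.HodgeConjecture.Cruxes.H413.F0P3KitOfRecord

open Summit.HodgeConjecture.HodgeConjecture.Cruxes.H413.F0P3InnerFormClassificationV6 (Sockets Gp Places Cinf IsCot KcTrivial)

/-- **K9α AT v8, GUARDED ROUTING — `letters_of_specPkgV8_cot`**: for a family `𝔇` of per-frame external data, IF at every letters' frame the kit of record satisfies the
witnessed package `SpecPkg` and the NAMED rows #1, TF, #2, #6, #7, #8, #10, #15 IN ITS GUARDED v8 TEXT (`IsCot P → KcTrivial P → …`), the arch clauses and the ξ-rows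
#20 #21 #23 — fourteen conjuncts at ONE level `S₀` per frame — THEN the HJ3a line's two letters hold (★ `letters_of_kitFamilyOfRecordV8` ∘ ★ `laws₈_kitOfRecord_of₄`, whose
`h15` IS the guarded row).  Same as ★ `letters_of_specPkgV8` except conjunct 9. [cite: Rogawski1990, §14.6 Thm. 14.6.4 pp. 236–244; §15.3 ¶1 p. 244; Prop. 15.2.1 (b)]
[cite: BorelWallach2000, VI Thm. 4.11] -/
theorem letters_of_specPkgV8_cot
    (𝔇 : ∀ (L : Type) [Field L] [NumberField L] [IsCMField L] (ι : L →+* ℂ) (H : Matrix (Fin 3) (Fin 3) L) (T : GL (Fin 3) ℂ)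
      (hT : (T : Matrix (Fin 3) (Fin 3) ℂ)ᴴ * H.map ι * (T : Matrix (Fin 3) (Fin 3) ℂ) = Literature.Geometry.ComplexHyperbolic.BallModel.J),
      (∀ τ' : L →+* ℂ, InfinitePlace.mk τ' ≠ InfinitePlace.mk ι → (H.map τ').PosDef) →
      2 ≤ Module.finrank ℚ ↥(maximalRealSubfield L) →
      ∀ (μ : Measure (Gp L H).automorphicQuotient) [(Gp L H).IsAutomorphicMeasure μ] (μω : HeckeCharacter L) (_hμu : μω.IsUnitary),
      (∀ x : Literature.NumberTheory.GaloisRepresentations.ideleGroup ↥(maximalRealSubfield L),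
        μω (AdeleRing.ideleBaseChange (↥(maximalRealSubfield L)) L x) = quadraticHeckeCharCM L x) → FrameData L H ι T hT μ)
    (h : ∀ (L : Type) [Field L] [NumberField L] [IsCMField L] (ι : L →+* ℂ) (H : Matrix (Fin 3) (Fin 3) L) (T : GL (Fin 3) ℂ)
      (hT : (T : Matrix (Fin 3) (Fin 3) ℂ)ᴴ * H.map ι * (T : Matrix (Fin 3) (Fin 3) ℂ) = Literature.Geometry.ComplexHyperbolic.BallModel.J)
      (hdef : ∀ τ' : L →+* ℂ, InfinitePlace.mk τ' ≠ InfinitePlace.mk ι → (H.map τ').PosDef) (h2 : 2 ≤ Module.finrank ℚ ↥(maximalRealSubfield L))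
      (μ : Measure (Gp L H).automorphicQuotient) [(Gp L H).IsAutomorphicMeasure μ] (μω : HeckeCharacter L) (hμu : μω.IsUnitary)
      (hμω : ∀ x : Literature.NumberTheory.GaloisRepresentations.ideleGroup ↥(maximalRealSubfield L),
        μω (AdeleRing.ideleBaseChange (↥(maximalRealSubfield L)) L x) = quadraticHeckeCharCM L x),
      -- ONE level `S₀` per frame (v8, RULING (V44)); the witnessed package at `S₀` (K9β: `Classical.choose_spec`, unioned by `.mono`)
      ∃ S₀ : Finset (Places L),
      F0P3InnerFormClassificationV8.ClassificationKit.SpecPkg (kitFamilyOfRecord 𝔇 L ι H T hT hdef h2 μ μω hμu hμω) S₀ ∧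
      -- #1 (T1's head at the overridden kit, K9β §A), TF (class factorisation), #2, #6, #7, #8, #10, #15 (v8 text, GUARDED `IsCot P → KcTrivial P → …` — ★ `routing₈_kitOfRecord_of_cot`)
      (kitFamilyOfRecord 𝔇 L ι H T hT hdef h2 μ μω hμu hμω).TraceIdentity ∧
      F0P3InnerFormClassificationV8.ClassificationKit.FactorisationCls (kitFamilyOfRecord 𝔇 L ι H T hT hdef h2 μ μω hμu hμω) S₀ ∧
      (kitFamilyOfRecord 𝔇 L ι H T hT hdef h2 μ μω hμu hμω).SpectralSideGp ∧
      F0P3InnerFormClassificationV8.ClassificationKit.HatBounded (kitFamilyOfRecord 𝔇 L ι H T hT hdef h2 μ μω hμu hμω) S₀ ∧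
      F0P3InnerFormClassificationV8.ClassificationKit.UnrStarAlgebra (kitFamilyOfRecord 𝔇 L ι H T hT hdef h2 μ μω hμu hμω) S₀ ∧
      (kitFamilyOfRecord 𝔇 L ι H T hT hdef h2 μ μω hμu hμω).LinIndepS ∧
      F0P3InnerFormClassificationV8.ClassificationKit.UnitaryPacket (kitFamilyOfRecord 𝔇 L ι H T hT hdef h2 μ μω hμu hμω) S₀ ∧
      F0P3InnerFormClassificationV8.ClassificationKit.Routing (kitFamilyOfRecord 𝔇 L ι H T hT hdef h2 μ μω hμu hμω) ∧
      -- the arch clauses on the family's `jInf dsInf` (R-22′) and the ξ-rows #20 #21 #23 (no #12 `FlathDet`, no «AFA»: RULINGS (V43)(V44))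
      JInfNoDegOne (𝔇 L ι H T hT hdef h2 μ μω hμu hμω).jInf ∧ DsInfNoDegOne (𝔇 L ι H T hT hdef h2 μ μω hμu hμω).dsInf ∧
      (kitFamilyOfRecord 𝔇 L ι H T hT hdef h2 μ μω hμu hμω).XiFamilyFin μω hμu ∧
      (kitFamilyOfRecord 𝔇 L ι H T hT hdef h2 μ μω hμu hμω).XiUnram ∧
      (kitFamilyOfRecord 𝔇 L ι H T hT hdef h2 μ μω hμu hμω).EvpConvention) :
    (∀ (L : Type) [Field L] [NumberField L] [IsCMField L] (ι : L →+* ℂ) (H : Matrix (Fin 3) (Fin 3) L) (T : GL (Fin 3) ℂ)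
      (hT : (T : Matrix (Fin 3) (Fin 3) ℂ)ᴴ * H.map ι * (T : Matrix (Fin 3) (Fin 3) ℂ) = Literature.Geometry.ComplexHyperbolic.BallModel.J),
      (∀ τ' : L →+* ℂ, InfinitePlace.mk τ' ≠ InfinitePlace.mk ι → (H.map τ').PosDef) →
      2 ≤ Module.finrank ℚ ↥(maximalRealSubfield L) →
      ∀ (μ : Measure (adelicGroupData (↥(maximalRealSubfield L)) L (IsCMField.complexConj L) 3 H).automorphicQuotient)
        [(adelicGroupData (↥(maximalRealSubfield L)) L (IsCMField.complexConj L) 3 H).IsAutomorphicMeasure μ]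
        (P : DiscreteAutomorphicRep (adelicGroupData (↥(maximalRealSubfield L)) L (IsCMField.complexConj L) 3 H) μ),
        (P.IsHolCotangentAt (cmArchSection L ι H T hT) (cmCompactFactor L ι H T hT) ∨
          P.IsAntiholCotangentAt (cmArchSection L ι H T hT) (cmCompactFactor L ι H T hT)) →
        ((adelicGroupData (↥(maximalRealSubfield L)) L (IsCMField.complexConj L) 3 H).rightRegular μ).multiplicity
            P.space.toContRep ≤ 1) ∧
    Literature.NumberTheory.Rogawski1990.hodgeTypeRigid := by
  refine letters_of_kitFamilyOfRecordV8 𝔇 fun L _ _ _ ι H T hT hdef h2 μ _ μω hμu hμω => ?_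
  obtain ⟨S₀, hpk, h1, hTF, h2', h6, h7, h8, h10, h15, hJ, hD, h20, h21, h23⟩ := h L ι H T hT hdef h2 μ μω hμu hμω
  letI : MeasurableSpace (Gp L H).Adelic := borel _
  haveI : BorelSpace (Gp L H).Adelic := ⟨rfl⟩
  haveI := (𝔇 L ι H T hT hdef h2 μ μω hμu hμω).isFiniteMeasureOnCompacts_ν
  exact ⟨S₀, laws₈_kitOfRecord_of₄ L H ι T hT μ _ _ _ μω hμu _ _ _ _ _ _ _ S₀ hdef h2 h1 h2'
    (F0P3InnerFormClassificationV8.ClassificationKit.factorisation_of_cls_of_pk _ hTF hpk.factorisationPk) hpk.matchingS hpk.transferS h6 h7 h8 h10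
    hpk.aPacketSpectral hpk.localExpansion h15 hμω hJ hD h20 h21 h23⟩

end Summit.HodgeConjecture.HodgeConjecture.Cruxes.H413.F0P3KitOfRecord

end
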